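import Literature.RepresentationTheory.KonnoKonno2007.RealUnitaryDualPairSL2
import Literature.Analysis.SegalBargmann.SchwartzCarrierTransport
import HarnessLib

/-!
# The `V ↔ W` swap symmetry of the real unitary dual-pair junction, and the `W`-side zero-point pin
(kernel, 0 records)

The concrete junction `RealDualPair.junction P Q R S` of
`Literature/RepresentationTheory/KonnoKonno2007/RealUnitaryDualPair.lean` realises
`U(P,Q) × U(R,S) → Sp(𝕎)`, `𝕎 = V ⊗_ℂ W`, through the PLAIN Kronecker product `g_V ⊗ₖ g_W`
(`RealDualPair.coe_toBig`, `RealDualPair.ι𝕎_apply`) in the block coordinates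
`DPIdx P Q R S = ((P × R) ⊕ (Q × S)) ⊕ ((P × S) ⊕ (Q × R))`.  This construction is SYMMETRIC under
exchanging the roles of `V` and `W`: the block relabelling
`swapIdx : DPIdx P Q R S ≃ DPIdx R S P Q` (same-sign blocks to same-sign blocks, mixed to mixed)
conjugates `ι𝕎_{P,Q,R,S}(g_V, g_W)` into `ι𝕎_{R,S,P,Q}(g_W, g_V)` (`ι𝕎_swap_apply`).  Transporting an
archimedean Weil datum along the corresponding coordinate permutation of the Schwartz carrier
(tree: `SchwartzCarrierTransport`, `IsArchWeilDatum.of_carrier`) therefore turns a vacuum character with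
exponents `(e_P, e_Q, e_R, e_S)` over `junction P Q R S` into one with exponents `(e_R, e_S, e_P, e_Q)`
over `junction R S P Q` (`RealDualPairJunction.FockVacuumCharacter.swap`), and the tree's `V`-side
zero-point pin `RealDualPair.eP_sub_eQ` (`RealUnitaryDualPairSL2`) (`e_P − e_Q = |R| − |S|`) yields the **`W`-side pin**
`RealDualPair.eR_sub_eS : e_R − e_S = |P| − |Q|` (for `W` indefinite).

CONSEQUENCE FOR THE PRINTED READING (`kk07Reading` of the record file `FockModelUnitaryDualPair`, whose
§4 object-match list this complements): Konno–Konno's Lemma 5.2 exponents, encoded by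
`kk07Reading m m′ ε p q p′ q′` (`e_P − e_Q = ε(q′ − p′)`, `e_R − e_S = ε(p − q)` — OPPOSITE patterns on
the two sides, because their Fock realisation `P(w) ↦ P(g⁻¹ w g′)` (§5.2 p. 72) lets `G_V` act
contragrediently), are a vacuum exponent of the tree's symmetric junction for NO sign `ε` as soon as all
four blocks are non-empty and `|P| ≠ |Q|`, `|R| ≠ |S|` (`not_fockVacuumCharacter_kk07Reading`): a
consumer transporting printed VALUES to the tree's junction must read KK07's `W`-side through the
dictionary `V* ⊗ W ↔ V ⊗ W` (on the pinned DIFFERENCE this is `e_R − e_S ↦ −(e_R − e_S)`; the absolute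
normalisation of `(e_R, e_S)` is NOT decided in this file — only the two differences are).  The RECORDS
(`FockVacuumCharacter`, `FockVacuumCharacterPrinted`) are unaffected — their exponent tuple is a parameter.

BOUNDARY.  Everything here is PROVED ([folklore] linear algebra and transport of structure); no statement
of print is used and no record is introduced or modified — the exponent tuple `e` of the records stays a
parameter.  Operator-level API for consumers (e.g. a `W`-side twin of a `V`-side operator family): the
Schwartz implementer `swapS` (`swapS_rhoS`, `toL2_swapS`), the `L²` unitary `l2Swap`, lifts
(`liftsTo_opTransport_swap`) and data (`isArchWeilDatum_swap`).

## Main results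
* `swapIdx` (`swapIdx_symm`: the inverse is the relabelling of the swapped pair), `reindex_swap_kronecker`,
  `ι𝕎_swap_apply` — the symmetry of the junction;
* `swapCLE`, `swapS`, `rhoSD_swapCLE`, `swapS_rhoS`, `l2Swap`, `liftsTo_opTransport_swap`,
  `isArchWeilDatum_swap` — transport of Heisenberg operators, lifts and Weil data along the swap;
* `RealDualPairJunction.FockVacuumCharacter.swap`, `RealDualPair.eR_sub_eS`,
  `RealDualPair.not_fockVacuumCharacter_kk07Reading`.

## References
* [KonnoKonno2007] K. Konno, T. Konno, Kyushu J. Math. 61 (2007), §3.1 (3.1), §5.2 p. 72 L7–10, Lemma 5.2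
  p. 73 (doi:10.2206/kyushujm.61.35) — conventions only, nothing cited as a fact.
* [Folland1989] G. B. Folland, *Harmonic Analysis in Phase Space* (1989), §1.3 (1.25), Prop. (4.39).
-/

set_option autoImplicit false

noncomputable section

open MeasureTheory Complex SchwartzMap Matrix
open scoped Kronecker ComplexConjugate
open Literature.Analysis.SegalBargmann Literature.RepresentationTheory.HeisenbergGroup
open Literature.NumberTheory.Weil1964
open Literature.NumberTheory.Automorphic Literature.NumberTheory.Automorphic.UnitaryGroup

namespace Literature.RepresentationTheory.KonnoKonno2007

namespace RealDualPair

/-! ## 1. The block relabelling `DPIdx P Q R S ≃ DPIdx R S P Q` -/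

section Relabel

variable (P Q R S : Type*)

/-- **The `V ↔ W` block relabelling**: `P×R ↦ R×P`, `Q×S ↦ S×Q` (same-sign blocks), `P×S ↦ S×P`,
`Q×R ↦ R×Q` (mixed blocks). [folklore] -/
def swapIdx : DPIdx P Q R S ≃ DPIdx R S P Q where
  toFun
    | Sum.inl (Sum.inl (p, r)) => Sum.inl (Sum.inl (r, p))
    | Sum.inl (Sum.inr (q, s)) => Sum.inl (Sum.inr (s, q))
    | Sum.inr (Sum.inl (p, s)) => Sum.inr (Sum.inr (s, p))
    | Sum.inr (Sum.inr (q, r)) => Sum.inr (Sum.inl (r, q))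
  invFun
    | Sum.inl (Sum.inl (r, p)) => Sum.inl (Sum.inl (p, r))
    | Sum.inl (Sum.inr (s, q)) => Sum.inl (Sum.inr (q, s))
    | Sum.inr (Sum.inr (s, p)) => Sum.inr (Sum.inl (p, s))
    | Sum.inr (Sum.inl (r, q)) => Sum.inr (Sum.inr (q, r))
  left_inv := by rintro ((⟨p, r⟩ | ⟨q, s⟩) | (⟨p, s⟩ | ⟨q, r⟩)) <;> rfl
  right_inv := by rintro ((⟨r, p⟩ | ⟨s, q⟩) | (⟨s, p⟩ | ⟨r, q⟩)) <;> rfl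

variable {P Q R S}

/-- `swapIdx ∘ dpEquiv_{PQRS} = dpEquiv_{RSPQ} ∘ Prod.swap`. [folklore] -/
theorem swapIdx_dpEquiv (x : (P ⊕ Q) × (R ⊕ S)) :
    swapIdx P Q R S (dpEquiv P Q R S x) = dpEquiv R S P Q x.swap := by
  rcases x with ⟨p | q, r | s⟩ <;> rfl

/-- **Involutivity across the two instantiations**: the inverse relabelling is the relabelling of the
swapped pair, so the reverse direction of every construction below is the same construction at
`(R, S, P, Q)`. [folklore] -/
theorem swapIdx_symm : (swapIdx P Q R S).symm = swapIdx R S P Q := by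
  ext x
  rcases x with ((⟨r, p⟩ | ⟨s, q⟩) | (⟨r, q⟩ | ⟨s, p⟩)) <;> rfl

/-- **The Kronecker swap under the relabelling**: `σ (g_V ⊗ g_W) σ⁻¹ = g_W ⊗ g_V` in block frames.
[folklore] -/
theorem reindex_swap_kronecker (A : Matrix (P ⊕ Q) (P ⊕ Q) ℂ) (B : Matrix (R ⊕ S) (R ⊕ S) ℂ) :
    Matrix.reindex (swapIdx P Q R S) (swapIdx P Q R S)
        (Matrix.reindex (dpEquiv P Q R S) (dpEquiv P Q R S) (A ⊗ₖ B)) =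
      Matrix.reindex (dpEquiv R S P Q) (dpEquiv R S P Q) (B ⊗ₖ A) := by
  ext i j
  obtain ⟨x, rfl⟩ := (dpEquiv R S P Q).surjective i
  obtain ⟨y, rfl⟩ := (dpEquiv R S P Q).surjective j
  have hx : (swapIdx P Q R S).symm (dpEquiv R S P Q x) = dpEquiv P Q R S x.swap := by
    rw [Equiv.symm_apply_eq, swapIdx_dpEquiv, Prod.swap_swap]
  have hy : (swapIdx P Q R S).symm (dpEquiv R S P Q y) = dpEquiv P Q R S y.swap := by
    rw [Equiv.symm_apply_eq, swapIdx_dpEquiv, Prod.swap_swap]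
  simp only [Matrix.reindex_apply, Matrix.submatrix_apply, hx, hy, Equiv.symm_apply_apply]
  rcases x with ⟨x1, x2⟩
  rcases y with ⟨y1, y2⟩
  simp [Matrix.kroneckerMap_apply, mul_comm]

/-- The relabelling preserves the twist (it maps `Sum.inl` to `Sum.inl`, `Sum.inr` to `Sum.inr`). [folklore] -/
theorem tw_comp_swapIdx (x : DPIdx R S P Q → ℂ) : tw (x ∘ swapIdx P Q R S) = tw x ∘ swapIdx P Q R S := by
  funext i
  rcases i with ((⟨p, r⟩ | ⟨q, s⟩) | (⟨p, s⟩ | ⟨q, r⟩)) <;> rfl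

/-- … and so does its inverse. [folklore] -/
theorem tw_comp_swapIdx_symm (y : DPIdx P Q R S → ℂ) :
    tw (y ∘ (swapIdx P Q R S).symm) = tw y ∘ (swapIdx P Q R S).symm := by
  funext j
  rcases j with ((⟨r, p⟩ | ⟨s, q⟩) | (⟨r, q⟩ | ⟨s, p⟩)) <;> rfl

/-- `(F ∘ σ⁻¹) ∘ σ = F`. [folklore] -/
@[simp] theorem comp_swapIdx_symm_comp {α : Type*} (F : DPIdx P Q R S → α) :
    (F ∘ (swapIdx P Q R S).symm) ∘ swapIdx P Q R S = F := by
  funext i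
  simp

end Relabel

/-! ## 2. The carrier transport `𝓢(ℝ^{DPIdx P Q R S}) → 𝓢(ℝ^{DPIdx R S P Q})` -/

section Carrier

variable (P Q R S : Type*) [Fintype P] [Fintype Q] [Fintype R] [Fintype S]

/-- the coordinate permutation `y ↦ y ∘ swapIdx⁻¹` as a continuous linear equivalence. [folklore] -/
def swapCLE : (DPIdx P Q R S → ℝ) ≃L[ℝ] (DPIdx R S P Q → ℝ) :=
  (LinearEquiv.funCongrLeft ℝ ℝ (swapIdx P Q R S).symm).toContinuousLinearEquiv

variable {P Q R S}

/-- `swapCLE y = y ∘ σ⁻¹`. [folklore] -/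
@[simp] theorem swapCLE_apply (y : DPIdx P Q R S → ℝ) (j : DPIdx R S P Q) :
    swapCLE P Q R S y j = y ((swapIdx P Q R S).symm j) := rfl

/-- `swapCLE⁻¹ x = x ∘ σ`, pointwise. [folklore] -/
@[simp] theorem swapCLE_symm_apply (x : DPIdx R S P Q → ℝ) (i : DPIdx P Q R S) :
    (swapCLE P Q R S).symm x i = x (swapIdx P Q R S i) := rfl

/-- `swapCLE⁻¹ x = x ∘ swapIdx`. [folklore] -/
theorem swapCLE_symm_eq (x : DPIdx R S P Q → ℝ) : (swapCLE P Q R S).symm x = x ∘ swapIdx P Q R S := rfl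

/-- `swapCLE⁻¹` is `swapCLE` of the swapped pair. [folklore] -/
theorem swapCLE_symm_apply_eq (x : DPIdx R S P Q → ℝ) : (swapCLE P Q R S).symm x = swapCLE R S P Q x := by
  funext i
  rw [swapCLE_symm_apply, swapCLE_apply, swapIdx_symm]

/-- The coordinate permutation preserves Lebesgue measure. [folklore] -/
theorem measurePreserving_swapCLE_symm :
    MeasurePreserving (swapCLE P Q R S).symm (volume : Measure (DPIdx R S P Q → ℝ)) volume := by
  have h := volume_measurePreserving_piCongrLeft (fun _ : DPIdx P Q R S => ℝ) (swapIdx P Q R S).symm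
  convert h using 1
  funext x
  funext i
  rw [MeasurableEquiv.coe_piCongrLeft, Equiv.piCongrLeft_apply_eq_cast]
  simp

/-- **The transported Heisenberg operators are the native ones at the relabelled point**:
`rhoSD swapCLE p q = ρ(p ∘ σ, q ∘ σ)`. [folklore] -/
theorem rhoSD_swapCLE (p q : DPIdx R S P Q → ℝ) (f : SchwartzMap (DPIdx P Q R S → ℝ) ℂ) :
    rhoSD (swapCLE P Q R S) p q f = rhoS (p ∘ swapIdx P Q R S) (q ∘ swapIdx P Q R S) f := by
  ext y
  rw [rhoSD_apply, rhoS_apply, swapCLE_symm_eq]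
  congr 1
  have h1 : ∑ j, q j * swapCLE P Q R S y j = ∑ i, (q ∘ swapIdx P Q R S) i * y i := by
    rw [← Equiv.sum_comp (swapIdx P Q R S)]
    simp only [swapCLE_apply, Equiv.symm_apply_apply, Function.comp_apply]
  have h2 : ∑ j, p j * q j = ∑ i, (p ∘ swapIdx P Q R S) i * (q ∘ swapIdx P Q R S) i := by
    rw [← Equiv.sum_comp (swapIdx P Q R S)]
    simp only [Function.comp_apply]
  simp only [rhoMul, h1, h2]

variable [DecidableEq P] [DecidableEq Q] [DecidableEq R] [DecidableEq S] in
/-- The Gaussian is permutation invariant: `h₀ ∘ σ = h₀`. [folklore] -/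
theorem schwartzTransport_symm_hermitePi_zero :
    (schwartzTransport (swapCLE P Q R S)).symm (hermitePi (0 : DPIdx R S P Q →₀ ℕ)) =
      hermitePi (0 : DPIdx P Q R S →₀ ℕ) := by
  ext y
  rw [schwartzTransport_symm_apply, hermitePi_apply, hermitePi_apply, herm_zero, herm_zero]
  simp only [hermiteFun, vac, MvPolynomial.eval_C, gauss, vacCoef,
    Fintype.card_congr (swapIdx P Q R S)]
  congr 3
  simp only [swapCLE_apply]
  exact (Equiv.sum_comp (swapIdx P Q R S) (fun j => ((y ((swapIdx P Q R S).symm j) : ℝ) : ℂ) ^ 2)).symm.trans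
    (by simp)

variable [DecidableEq P] [DecidableEq Q] [DecidableEq R] [DecidableEq S] in
/-- … forward direction. [folklore] -/
theorem schwartzTransport_hermitePi_zero :
    schwartzTransport (swapCLE P Q R S) (hermitePi (0 : DPIdx P Q R S →₀ ℕ)) =
      hermitePi (0 : DPIdx R S P Q →₀ ℕ) := by
  rw [← schwartzTransport_symm_hermitePi_zero, ContinuousLinearEquiv.apply_symm_apply]

/-- The coordinate permutation itself preserves Lebesgue measure. [folklore] -/
theorem measurePreserving_swapCLE :
    MeasurePreserving (swapCLE P Q R S) (volume : Measure (DPIdx P Q R S → ℝ)) volume := by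
  have h := volume_measurePreserving_piCongrLeft (fun _ : DPIdx R S P Q => ℝ) (swapIdx P Q R S)
  convert h using 1
  funext y
  funext j
  rw [MeasurableEquiv.coe_piCongrLeft, Equiv.piCongrLeft_apply_eq_cast]
  simp

variable (P Q R S)

/-- **The Schwartz implementer of the swap**: `swapS = (f ↦ f ∘ σ_*⁻¹) : 𝓢(ℝ^{DPIdx P Q R S}) ≃L 𝓢(ℝ^{DPIdx R S P Q})`,
the tree's `schwartzTransport` of `swapCLE`. [folklore] -/
abbrev swapS : SchwartzMap (DPIdx P Q R S → ℝ) ℂ ≃L[ℂ] SchwartzMap (DPIdx R S P Q → ℝ) ℂ :=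
  schwartzTransport (swapCLE P Q R S)

variable {P Q R S}

/-- `swapS` intertwines the Heisenberg operators at relabelled points:
`swapS (ρ(p ∘ σ, q ∘ σ) f) = ρ(p, q) (swapS f)`. [folklore] -/
theorem swapS_rhoS (p q : DPIdx R S P Q → ℝ) (f : SchwartzMap (DPIdx P Q R S → ℝ) ℂ) :
    swapS P Q R S (rhoS (p ∘ swapIdx P Q R S) (q ∘ swapIdx P Q R S) f) = rhoS p q (swapS P Q R S f) := by
  rw [← rhoSD_swapCLE, schwartzTransport_rhoSD]

/-- … equivalently `swapS⁻¹ (ρ(p, q) f) = ρ(p ∘ σ, q ∘ σ) (swapS⁻¹ f)`. [folklore] -/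
theorem swapS_symm_rhoS (p q : DPIdx R S P Q → ℝ) (f : SchwartzMap (DPIdx R S P Q → ℝ) ℂ) :
    (swapS P Q R S).symm (rhoS p q f) =
      rhoS (p ∘ swapIdx P Q R S) (q ∘ swapIdx P Q R S) ((swapS P Q R S).symm f) := by
  rw [schwartzTransport_symm_rhoS, rhoSD_swapCLE]

/-- `swapS⁻¹` is `swapS` of the swapped pair. [folklore] -/
theorem swapS_symm_apply_eq (f : SchwartzMap (DPIdx R S P Q → ℝ) ℂ) :
    (swapS P Q R S).symm f = swapS R S P Q f := by
  ext y
  rw [schwartzTransport_symm_apply, schwartzTransport_apply, swapCLE_symm_apply_eq]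

/-! ## 3. The `L²` side: the permutation unitary and transport of lifts -/

/-- `(g ∘ σ_*) ∘ σ_*⁻¹ = g` in `L²`: the transport of `g ∘ swapCLE` is `g`. [folklore] -/
theorem l2Transport_compMeasurePreserving (g : Lp ℂ 2 (volume : Measure (DPIdx R S P Q → ℝ))) :
    l2Transport (swapCLE P Q R S) measurePreserving_swapCLE_symm
        (Lp.compMeasurePreserving (swapCLE P Q R S) measurePreserving_swapCLE g) = g := by
  apply Lp.ext
  have h1 := coeFn_l2Transport (swapCLE P Q R S) measurePreserving_swapCLE_symm
    (Lp.compMeasurePreserving (swapCLE P Q R S) measurePreserving_swapCLE g)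
  have h2 : (fun x : DPIdx R S P Q → ℝ =>
      (Lp.compMeasurePreserving (swapCLE P Q R S) measurePreserving_swapCLE g : (DPIdx P Q R S → ℝ) → ℂ)
        ((swapCLE P Q R S).symm x)) =ᵐ[volume]
      fun x => (g ∘ swapCLE P Q R S) ((swapCLE P Q R S).symm x) :=
    measurePreserving_swapCLE_symm.quasiMeasurePreserving.ae_eq_comp
      (Lp.coeFn_compMeasurePreserving g measurePreserving_swapCLE)
  filter_upwards [h1, h2] with x hx1 hx2
  rw [hx1, hx2, Function.comp_apply, ContinuousLinearEquiv.apply_symm_apply]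

variable (P Q R S)

/-- **The permutation unitary** `g ↦ g ∘ σ_*⁻¹ : L²(ℝ^{DPIdx P Q R S}) ≃ₗᵢ L²(ℝ^{DPIdx R S P Q})`. [folklore] -/
def l2Swap : Lp ℂ 2 (volume : Measure (DPIdx P Q R S → ℝ)) ≃ₗᵢ[ℂ] Lp ℂ 2 (volume : Measure (DPIdx R S P Q → ℝ)) :=
  LinearIsometryEquiv.ofSurjective (l2Transport (swapCLE P Q R S) measurePreserving_swapCLE_symm)
    fun g => ⟨_, l2Transport_compMeasurePreserving g⟩

variable {P Q R S}

/-- unfolding. [folklore] -/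
theorem l2Swap_apply (g : Lp ℂ 2 (volume : Measure (DPIdx P Q R S → ℝ))) :
    l2Swap P Q R S g = l2Transport (swapCLE P Q R S) measurePreserving_swapCLE_symm g := rfl

/-- `toL2 (f ∘ σ_*⁻¹) = l2Swap (toL2 f)`. [folklore] -/
theorem toL2_schwartzTransport_swapCLE (f : SchwartzMap (DPIdx P Q R S → ℝ) ℂ) :
    toL2 (schwartzTransport (swapCLE P Q R S) f) = l2Swap P Q R S (toL2 f) :=
  toL2_schwartzTransport (swapCLE P Q R S) measurePreserving_swapCLE_symm f

/-- `toL2 ∘ swapS = l2Swap ∘ toL2`. [folklore] -/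
theorem toL2_swapS (f : SchwartzMap (DPIdx P Q R S → ℝ) ℂ) :
    toL2 (swapS P Q R S f) = l2Swap P Q R S (toL2 f) :=
  toL2_schwartzTransport_swapCLE f

/-- **Transport of lifts along the swap**: if `A` on `𝓢` is the restriction of `U` on `L²`, then
`swapS ∘ A ∘ swapS⁻¹` is the restriction of any `V` with `l2Swap ∘ U = V ∘ l2Swap`. [folklore] -/
theorem liftsTo_opTransport_swap {A : SchwartzMap (DPIdx P Q R S → ℝ) ℂ →ₗ[ℂ] SchwartzMap (DPIdx P Q R S → ℝ) ℂ}
    {U : Lp ℂ 2 (volume : Measure (DPIdx P Q R S → ℝ)) →L[ℂ] Lp ℂ 2 (volume : Measure (DPIdx P Q R S → ℝ))}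
    (hA : LiftsTo A U)
    (V : Lp ℂ 2 (volume : Measure (DPIdx R S P Q → ℝ)) →L[ℂ] Lp ℂ 2 (volume : Measure (DPIdx R S P Q → ℝ)))
    (hV : ∀ g, l2Swap P Q R S (U g) = V (l2Swap P Q R S g)) :
    LiftsTo (opTransport (swapCLE P Q R S) A) V := by
  intro f
  rw [opTransport_apply, toL2_schwartzTransport_swapCLE, hA, hV, ← toL2_schwartzTransport_swapCLE,
    ContinuousLinearEquiv.apply_symm_apply]

end Carrier

/-! ## 4. The symmetry of `ι𝕎` on phase space -/

section Junction

variable {P Q R S : Type*} [Fintype P] [DecidableEq P] [Fintype Q] [DecidableEq Q]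
  [Fintype R] [DecidableEq R] [Fintype S] [DecidableEq S]

omit [DecidableEq P] [DecidableEq Q] [DecidableEq R] [DecidableEq S] in
/-- twisted action of a relabelled matrix. [folklore] -/
theorem twMulVec_reindex_swapIdx (M : Matrix (DPIdx P Q R S) (DPIdx P Q R S) ℂ) (X : DPIdx R S P Q → ℂ) :
    twMulVec (Matrix.reindex (swapIdx P Q R S) (swapIdx P Q R S) M) X =
      twMulVec M (X ∘ swapIdx P Q R S) ∘ (swapIdx P Q R S).symm := by
  rw [twMulVec, twMulVec, reindex_mulVec, ← tw_comp_swapIdx, tw_comp_swapIdx_symm]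

/-- **`ι𝕎` is `V ↔ W` symmetric**: `ι𝕎_{RSPQ}(g_W, g_V)` is `ι𝕎_{PQRS}(g_V, g_W)` conjugated by the
coordinate permutation `swapIdx`. [folklore] -/
theorem ι𝕎_swap_apply (g : Ginf R S P Q) (w : (DPIdx R S P Q → ℝ) × (DPIdx R S P Q → ℝ)) :
    (ι𝕎 R S P Q g).1 w =
      ((((ι𝕎 P Q R S (g.2, g.1)).1 (w.1 ∘ swapIdx P Q R S, w.2 ∘ swapIdx P Q R S)).1 ∘ (swapIdx P Q R S).symm),
       (((ι𝕎 P Q R S (g.2, g.1)).1 (w.1 ∘ swapIdx P Q R S, w.2 ∘ swapIdx P Q R S)).2 ∘ (swapIdx P Q R S).symm)) := by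
  rw [ι𝕎_apply, ι𝕎_apply, ← reindex_swap_kronecker]
  have hφ : phasePt (w.1 ∘ swapIdx P Q R S) (w.2 ∘ swapIdx P Q R S) = phasePt w.1 w.2 ∘ swapIdx P Q R S := rfl
  refine Prod.ext (funext fun k => ?_) (funext fun k => ?_)
  · show (twMulVec _ (phasePt w.1 w.2) k).re = (twMulVec _ (phasePt _ _) _).re
    rw [twMulVec_reindex_swapIdx, hφ]
    rfl
  · show (twMulVec _ (phasePt w.1 w.2) k).im = (twMulVec _ (phasePt _ _) _).im
    rw [twMulVec_reindex_swapIdx, hφ]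
    rfl

/-! ## 5. Transport of an archimedean Weil datum along the swap -/

variable (P Q R S)

/-- `(g_W, g_V) ↦ (g_V, g_W)` as a homomorphism `G_∞(R,S,P,Q) →* G_∞(P,Q,R,S)`. [folklore] -/
def swapHom : Ginf R S P Q →* Ginf P Q R S := (MulEquiv.prodComm : Ginf R S P Q ≃* Ginf P Q R S).toMonoidHom

variable {P Q R S}

/-- unfolding. [folklore] -/
@[simp] theorem swapHom_apply (g : Ginf R S P Q) : swapHom P Q R S g = (g.2, g.1) := rfl

/-- **A Weil datum over `ι𝕎_{P,Q,R,S}` transports to one over `ι𝕎_{R,S,P,Q}`**: conjugate by `swapS` and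
precompose with the swap of the two factors. [folklore] -/
theorem isArchWeilDatum_swap {ω : Representation ℂ (Ginf P Q R S) (SchwartzMap (DPIdx P Q R S → ℝ) ℂ)}
    (hW : IsArchWeilDatum (ι𝕎 P Q R S) ω) :
    IsArchWeilDatum (ι𝕎 R S P Q) (repTransport (swapCLE P Q R S) (ω.comp (swapHom P Q R S))) := by
  refine IsArchWeilDatum.of_carrier (swapCLE P Q R S) ?_ ?_ ?_
  · intro Φ
    exact (hW.continuous_apply Φ).comp
      (continuous_swap : Continuous fun g : Ginf R S P Q => ((g.2, g.1) : Ginf P Q R S))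
  · intro g p q f
    have hcov := hW.covariant (g.2, g.1) (p ∘ swapIdx P Q R S) (q ∘ swapIdx P Q R S) f
    show ω (g.2, g.1) (rhoSD (swapCLE P Q R S) p q f) =
      rhoSD (swapCLE P Q R S) ((ι𝕎 R S P Q g).1 (p, q)).1 ((ι𝕎 R S P Q g).1 (p, q)).2 (ω (g.2, g.1) f)
    rw [rhoSD_swapCLE, rhoSD_swapCLE, hcov, ι𝕎_swap_apply]
    simp only [comp_swapIdx_symm_comp]
  · intro g
    obtain ⟨U, hU⟩ := hW.exists_lift (g.2, g.1)
    refine ⟨((l2Swap P Q R S).symm.trans U).trans (l2Swap P Q R S), ?_⟩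
    exact liftsTo_opTransport_swap hU _ fun x => by simp

/-! ## 6. The vacuum character under the swap; the `W`-side zero-point pin -/

/-- relabelling the exponents: `det a^{e_P} det b^{e_Q} det c^{e_R} det d^{e_S}` read on `((c,d),(a,b))`. [folklore] -/
theorem vacScalar_swap (e : VacExponents) (k : DPK R S P Q) :
    vacScalar e ((k.2, k.1) : DPK P Q R S) = vacScalar ⟨e.eR, e.eS, e.eP, e.eQ⟩ k := by
  simp only [vacScalar]
  ring

/-- `κ` commutes with the swap. [folklore] -/
theorem swapHom_κ (k : DPK R S P Q) : swapHom P Q R S (κ R S P Q k) = κ P Q R S (k.2, k.1) := rfl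

/-- **The vacuum character is `V ↔ W` symmetric**: exponents `(e_P, e_Q, e_R, e_S)` over `junction P Q R S`
give exponents `(e_R, e_S, e_P, e_Q)` over `junction R S P Q`. [folklore] -/
theorem _root_.Literature.RepresentationTheory.KonnoKonno2007.RealDualPairJunction.FockVacuumCharacter.swap
    {e : VacExponents} (h : (junction P Q R S).FockVacuumCharacter e) :
    (junction R S P Q).FockVacuumCharacter ⟨e.eR, e.eS, e.eP, e.eQ⟩ := by
  obtain ⟨ω, hW, hvac⟩ := h
  rw [junction_ι𝕎] at hW
  refine ⟨repTransport (swapCLE P Q R S) (ω.comp (swapHom P Q R S)), ?_, fun k => ?_⟩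
  · rw [junction_ι𝕎]
    exact isArchWeilDatum_swap hW
  · have hk := hvac (k.2, k.1)
    rw [junction_κ] at hk
    rw [repTransport_apply, junction_κ, MonoidHom.comp_apply, swapHom_κ, schwartzTransport_symm_hermitePi_zero,
      hk, map_smul, schwartzTransport_hermitePi_zero, vacScalar_swap]

/-- … and back (the swap is an involution on exponents). [folklore] -/
theorem _root_.Literature.RepresentationTheory.KonnoKonno2007.RealDualPairJunction.FockVacuumCharacter.swap_iff
    {e : VacExponents} :
    (junction R S P Q).FockVacuumCharacter ⟨e.eR, e.eS, e.eP, e.eQ⟩ ↔ (junction P Q R S).FockVacuumCharacter e :=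
  ⟨fun h => by simpa using h.swap, fun h => h.swap⟩

/-- **Zero-point pin, `W` side**: `e_R − e_S = |P| − |Q|` for every vacuum character over `U(P,Q) × U(R,S)`
with `W` indefinite (`R`, `S` nonempty) — the SAME sign pattern as the `V` side (`RealDualPair.eP_sub_eQ`:
`e_P − e_Q = |R| − |S|`), by the swap symmetry of the junction. [folklore] -/
theorem eR_sub_eS {e : VacExponents} (h : (junction P Q R S).FockVacuumCharacter e) (r₀ : R) (s₀ : S) :
    e.eR - e.eS = (Fintype.card P : ℤ) - Fintype.card Q :=
  eP_sub_eQ h.swap r₀ s₀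

/-- On the `W` side the two block exponents of the printed reading differ by `ε (p − q)`. [folklore] -/
theorem kk07Reading_eR_sub_eS (m m' ε : ℤ) (p q p' q' : ℕ) (hε : ε = 1 ∨ ε = -1)
    (hm' : Even (m' + ((p : ℤ) + q))) :
    (kk07Reading m m' ε p q p' q').eR - (kk07Reading m m' ε p q p' q').eS = ε * ((p : ℤ) - q) := by
  obtain ⟨r, hr⟩ := hm'
  simp only [kk07Reading]
  rcases hε with h | h
  · subst h
    have h1 : (m' + 1 * ((p : ℤ) - q)) = 2 * (r - q) := by linarith
    have h2 : (m' + 1 * ((q : ℤ) - p)) = 2 * (r - p) := by linarith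
    rw [h1, h2, Int.mul_ediv_cancel_left _ two_ne_zero, Int.mul_ediv_cancel_left _ two_ne_zero]
    ring
  · subst h
    have h1 : (m' + -1 * ((p : ℤ) - q)) = 2 * (r - p) := by linarith
    have h2 : (m' + -1 * ((q : ℤ) - p)) = 2 * (r - q) := by linarith
    rw [h1, h2, Int.mul_ediv_cancel_left _ two_ne_zero, Int.mul_ediv_cancel_left _ two_ne_zero]
    ring

/-- **Reading caveat K-3, kernel form**: over a fully indefinite junction with `|P| ≠ |Q|` and `|R| ≠ |S|`
the Konno–Konno exponent tuple `kk07Reading m m′ ε |P| |Q| |R| |S|` (printed parities, `ε = ±1`) is a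
vacuum exponent for NEITHER sign: the `V`-side pin forces `ε = −1`, the `W`-side pin forces `ε = +1`
(KK07's realisation `P(w) ↦ P(g⁻¹ w g′)` is `V* ⊗ W`; the tree's junction is the plain `V ⊗ W`). [folklore] -/
theorem not_fockVacuumCharacter_kk07Reading (m m' ε : ℤ) (hε : ε = 1 ∨ ε = -1)
    (hm : Even (m + ((Fintype.card R : ℤ) + Fintype.card S)))
    (hm' : Even (m' + ((Fintype.card P : ℤ) + Fintype.card Q)))
    (p₀ : P) (q₀ : Q) (r₀ : R) (s₀ : S)
    (hPQ : Fintype.card P ≠ Fintype.card Q) (hRS : Fintype.card R ≠ Fintype.card S) :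
    ¬ (junction P Q R S).FockVacuumCharacter
      (kk07Reading m m' ε (Fintype.card P) (Fintype.card Q) (Fintype.card R) (Fintype.card S)) := by
  intro h
  have hV := eP_sub_eQ h p₀ q₀
  have hW := eR_sub_eS h r₀ s₀
  rw [kk07Reading_eP_sub_eQ _ _ _ _ _ _ _ hε hm] at hV
  rw [kk07Reading_eR_sub_eS _ _ _ _ _ _ _ hε hm'] at hW
  rcases hε with h1 | h1
  · subst h1
    apply hRS
    have h0 : ((Fintype.card R : ℤ) - Fintype.card S) = 0 := by linarith
    exact_mod_cast sub_eq_zero.mp h0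
  · subst h1
    apply hPQ
    have h0 : ((Fintype.card P : ℤ) - Fintype.card Q) = 0 := by linarith
    exact_mod_cast sub_eq_zero.mp h0

end Junction

end RealDualPair

end Literature.RepresentationTheory.KonnoKonno2007

end
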